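import Mathlib
import Summits.Ventures.PercRepro2.Defs
import Summits.Ventures.PercRepro2.Independence
import Summits.Ventures.PercRepro2.Harris
import Summits.Ventures.PercRepro2.Graph
import Summits.Ventures.PercRepro2.Events
import Summits.Ventures.PercRepro2.GateCylinder
import Summits.Ventures.PercRepro2.CCTRootEdge
import Summits.Ventures.PercRepro2.CDNestedStep
import Summits.Ventures.PercRepro2.CDNestedRouteChain
import Summits.Ventures.PercRepro2.CDNestedRoute
import Summits.Ventures.PercRepro2.CDNestedEdgeLemmas
import Summits.Ventures.PercRepro2.CDNestedMixture
import Summits.Ventures.PercRepro2.CDNestedInternal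

/-!
# THE NESTED-ROUTES THEOREM of row 2′CD, for any number of routes (blind cell PercRepro2, mine-a g35;
MINE-A.md §90, proofs/MINEA-CD-NESTED.md)

Routes `L 0, …, L (k-1)` (walk-ordered lists of triples `(e, v, y)` from `a₁`, each reaching `a₃`) with
edge sets `B i` and vertex sets `S i`, NESTED: `S l ⊆ S i` for `l < i`.  If under `Q = {a₁ ↮ a₂}` the
event `{a₁ ↔ a₃}` is the union of the cylinders of the routes (`hQe`), then the row holds for every
up-set and every weight vector (`cd_of_nested_routes`).

Proof (MINEA-CD-NESTED.md §1–§3).  `prob_inter_routes_eq_sum`: the first-index partition of the union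
writes every connectivity-determined mass as `∑_i ν_i P_{p[B i ↦ 1]}(X)` with
`ν_i = (∏_{B i} p) · P_{p[B i ↦ 1]}(⋂_{l<i} cyl(B l)ᶜ)` — the event «no earlier route is open» reads
only edges of `⋃_{l<i} B l`, internal to `S i` (nesting), so under `p[B i ↦ 1]` it is independent of `X`
(`CDNestedInternal.prob_forceOpen_inter_internal`).  The propensities are ordered along the index:
pinning the route `L j` from the world `B i` (`CDNestedRouteChain.chain_beta` / `chain_gamma`) reaches
the forced set `B j ∪ B i`, whose masses are those of `B j` because `B i` is internal to `S j`
(`CDNestedInternal.prob_forceOpen_union_internal`).  `CDNestedMixture.cd_of_worlds` closes.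
No definition; one seat.
-/

namespace Summit.Ventures.PercRepro2

namespace CDNestedRoutes

section Decomposition

variable {V : Type*} {E : Type*} [Fintype E] [DecidableEq E]
  {R : Type*} [Field R] [LinearOrder R] [IsStrictOrderedRing R]

omit [LinearOrder R] [IsStrictOrderedRing R] in
/-- **The route decomposition of a connectivity-determined mass**: for edge sets `B i` joining the
nested vertex sets `S i`, `P_p(X ∩ ⋃_{i<k} cyl(B i)) = ∑_{i<k} ν_i · P_{p[B i ↦ 1]}(X)` with
`ν_i = (∏_{B i} p) · P_{p[B i ↦ 1]}(⋂_{l<i} cyl(B l)ᶜ)`. -/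
theorem prob_inter_routes_eq_sum (p : E → R) {ends : E → Sym2 V} {a₁ : V} (k : ℕ)
    (B : ℕ → Finset E) (S : ℕ → Finset V)
    (hJ : ∀ i, i < k → ∀ ω : Config E, ω ∈ GateCylinder.cylinder (B i) → ∀ v ∈ S i, Conn ends ω a₁ v)
    (hint : ∀ i, i < k → ∀ b ∈ B i, ∃ x ∈ S i, ∃ y ∈ S i, ends b = s(x, y))
    (hnest : ∀ l i, l < i → i < k → S l ⊆ S i) (X : Set (Config E))
    (hX : ∀ ω ω' : Config E, (∀ u w, Conn ends ω u w ↔ Conn ends ω' u w) → (ω ∈ X ↔ ω' ∈ X)) :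
    prob p (X ∩ ⋃ i ∈ Finset.range k, GateCylinder.cylinder (B i)) =
      ∑ i ∈ Finset.range k, ((∏ b ∈ B i, p b) * prob (GateCylinder.forceOpen p (B i))
        (⋂ l ∈ Finset.range i, (GateCylinder.cylinder (B l))ᶜ)) *
          prob (GateCylinder.forceOpen p (B i)) X := by
  rw [CDNestedInternal.prob_inter_biUnion_eq_sum]
  refine Finset.sum_congr rfl fun i hi => ?_
  rw [Finset.mem_range] at hi
  have e1 : X ∩ GateCylinder.cylinder (B i) ∩ ⋂ l ∈ Finset.range i, (GateCylinder.cylinder (B l))ᶜ =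
      (X ∩ ⋂ l ∈ Finset.range i, (GateCylinder.cylinder (B l))ᶜ) ∩ GateCylinder.cylinder (B i) := by
    ext ω; simp only [Set.mem_inter_iff]; tauto
  rw [e1, GateCylinder.prob_inter_cylinder]
  -- the event «no earlier route is open» reads only the edges of the earlier routes
  have hF : ∀ f ∈ (Finset.range i).biUnion B, ∃ x ∈ S i, ∃ y ∈ S i, ends f = s(x, y) := by
    intro f hf
    rw [Finset.mem_biUnion] at hf
    obtain ⟨l, hl, hfl⟩ := hf
    rw [Finset.mem_range] at hl
    obtain ⟨x, hx, y, hy, hxy⟩ := hint l (by omega) f hfl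
    exact ⟨x, hnest l i hl hi hx, y, hnest l i hl hi hy, hxy⟩
  have hY : DependsOn (· ∈ ⋂ l ∈ Finset.range i, (GateCylinder.cylinder (B l))ᶜ)
      (↑((Finset.range i).biUnion B) : Set E) := by
    intro ω ω' h
    have hcyl : ∀ l, l < i →
        (ω ∈ GateCylinder.cylinder (B l) ↔ ω' ∈ GateCylinder.cylinder (B l)) := by
      intro l hl
      simp only [GateCylinder.cylinder, Set.mem_setOf_eq]
      refine forall_congr' fun b => imp_congr_right fun hb => ?_
      rw [h b (by simp only [Finset.coe_biUnion, Finset.coe_range, Set.mem_iUnion, Finset.mem_coe,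
        Set.mem_Iio, exists_prop]; exact ⟨l, hl, hb⟩)]
    apply propext
    simp only [Set.mem_iInter, Set.mem_compl_iff, Finset.mem_range]
    exact forall_congr' fun l => imp_congr_right fun hl => not_congr (hcyl l hl)
  rw [CDNestedInternal.prob_forceOpen_inter_internal p (hJ i hi) hF X _ hX hY]
  ring

end Decomposition

section Theorem

variable {V : Type*} {E : Type*} [Fintype E] [DecidableEq E] [Fintype V] [DecidableEq V]
  {R : Type*} [Field R] [LinearOrder R] [IsStrictOrderedRing R]

/-- **THE NESTED-ROUTES THEOREM (row 2′CD).** Routes `L i` (`i < k`), each a walk-ordered list of triples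
`(e, v, y)` from `a₁` (`ends e = s(v, y)`, every `v` is `a₁` or an earlier `y`) reaching `a₃`, with edge
sets `B i` and vertex sets `S i`, NESTED (`S l ⊆ S i` for `l < i < k`); under `Q = {a₁ ↮ a₂}` the
event `{a₁ ↔ a₃}` is the union of the cylinders of the routes.  Then the row holds for every up-set
and every weight vector. -/
theorem cd_of_nested_routes (p : E → R) (hp : IsProbVec p) {ends : E → Sym2 V} {a₁ a₂ a₃ o : V}
    (k : ℕ) (L : ℕ → List (E × V × V)) (B : ℕ → Finset E) (S : ℕ → Finset V)
    (hB : ∀ i, i < k → B i = (L i).foldl (fun acc t => insert t.1 acc) (∅ : Finset E))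
    (hS : ∀ i, i < k → S i = (L i).foldl (fun acc t => insert t.2.2 acc) ({a₁} : Finset V))
    (hends : ∀ i, i < k → ∀ t ∈ L i, ends t.1 = s(t.2.1, t.2.2))
    (hwalk : ∀ i, i < k → ∀ j (hj : j < (L i).length), ((L i).get ⟨j, hj⟩).2.1 ∈
      ({a₁} : Finset V) ∪ (((L i).take j).map (fun u => u.2.2)).toFinset)
    (hnest : ∀ l i, l < i → i < k → S l ⊆ S i) {𝓔 : Set (Set V)} (h𝓔 : IsUpperSet 𝓔)
    (hQe : (connEvent ends a₁ a₂)ᶜ ∩ connEvent ends a₁ a₃ =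
      (connEvent ends a₁ a₂)ᶜ ∩ ⋃ i ∈ Finset.range k, GateCylinder.cylinder (B i)) :
    let Q := (connEvent ends a₁ a₂)ᶜ
    let U := clusterInEvent ends a₁ 𝓔
    let e := connEvent ends a₁ a₃
    let f := connEvent ends a₂ o
    let N := (connEvent ends a₁ a₃)ᶜ ∩ (connEvent ends a₂ a₃)ᶜ
    let oU := connEvent ends a₁ o ∪ connEvent ends a₂ o
    prob p (Q ∩ N) * (prob p Q * prob p (Q ∩ U ∩ e ∩ f) - prob p (Q ∩ U) * prob p (Q ∩ e ∩ f)) ≤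
      prob p (Q ∩ N ∩ oU) * (prob p Q * prob p (Q ∩ U ∩ e) - prob p (Q ∩ U) * prob p (Q ∩ e)) := by
  intro Q U e f N oU
  set W := ⋃ i ∈ Finset.range k, GateCylinder.cylinder (B i) with hW
  -- the routes join their vertex sets, contain `a₁`, and their edges are internal
  have hJ : ∀ i, i < k → ∀ ω : Config E, ω ∈ GateCylinder.cylinder (B i) →
      ∀ v ∈ S i, Conn ends ω a₁ v := by
    intro i hi ω hω v hv
    rw [hB i hi] at hω
    rw [hS i hi] at hv
    exact CDNestedRoute.chain_joined (L i) ∅ {a₁} (CDNestedStep.joined_singleton ends ∅ a₁)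
      (hends i hi) (hwalk i hi) ω hω v hv
  have ha₁ : ∀ i, i < k → a₁ ∈ S i := by
    intro i hi
    rw [hS i hi]
    exact CDNestedInternal.subset_foldl_insert (L i) {a₁} (Finset.mem_singleton_self a₁)
  have hint : ∀ i, i < k → ∀ b ∈ B i, ∃ x ∈ S i, ∃ y ∈ S i, ends b = s(x, y) := by
    intro i hi b hb
    rw [hB i hi, CDNestedInternal.mem_foldl_insert_edges] at hb
    rcases hb with hb | ⟨t, ht, rfl⟩
    · exact absurd hb (Finset.notMem_empty b)
    · refine ⟨t.2.1, ?_, t.2.2, ?_, hends i hi t ht⟩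
      · rw [hS i hi]; exact CDNestedInternal.fst_mem_foldl_of_walk (hwalk i hi) t ht
      · rw [hS i hi]; exact CDNestedInternal.snd_mem_foldl_insert (L i) {a₁} t ht
  -- the four events are determined by the connections
  have hconn : ∀ X : Set (Config E), (X = Q ∨ X = Q ∩ U ∨ X = Q ∩ f ∨ X = Q ∩ U ∩ f) →
      ∀ ω ω' : Config E, (∀ u w, Conn ends ω u w ↔ Conn ends ω' u w) → (ω ∈ X ↔ ω' ∈ X) := by
    intro X hX ω ω' hc
    have hcl := CDNestedEdge.cluster_eq_of_conn_iff hc a₁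
    rcases hX with rfl | rfl | rfl | rfl
    · simp only [Q, Set.mem_compl_iff, mem_connEvent, hc]
    · simp only [Q, U, Set.mem_inter_iff, Set.mem_compl_iff, mem_connEvent, mem_clusterInEvent, hc,
        hcl]
    · simp only [Q, f, Set.mem_inter_iff, Set.mem_compl_iff, mem_connEvent, hc]
    · simp only [Q, U, f, Set.mem_inter_iff, Set.mem_compl_iff, mem_connEvent, mem_clusterInEvent,
        hc, hcl]
  -- the pointwise form of `hQe`
  have hpt : ∀ ω, ω ∈ Q → (ω ∈ e ↔ ω ∈ W) := by
    intro ω hQ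
    have h := Set.ext_iff.1 hQe ω
    simp only [Set.mem_inter_iff] at h
    exact ⟨fun he => (h.1 ⟨hQ, he⟩).2, fun hc => (h.2 ⟨hQ, hc⟩).2⟩
  have eA : Q ∩ U ∩ e ∩ f = (Q ∩ U ∩ f) ∩ W := by
    ext ω; have h := hpt ω; simp only [Set.mem_inter_iff]; tauto
  have eB : Q ∩ U ∩ e = (Q ∩ U) ∩ W := by
    ext ω; have h := hpt ω; simp only [Set.mem_inter_iff]; tauto
  have eC : Q ∩ e ∩ f = (Q ∩ f) ∩ W := by
    ext ω; have h := hpt ω; simp only [Set.mem_inter_iff]; tauto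
  have eD : Q ∩ e = Q ∩ W := hQe
  -- the worlds and their weights
  have hwp : ∀ i, IsProbVec (GateCylinder.forceOpen p (B i)) :=
    fun i => GateCylinder.isProbVec_forceOpen hp (B i)
  have hν0 : ∀ i, 0 ≤ (∏ b ∈ B i, p b) * prob (GateCylinder.forceOpen p (B i))
      (⋂ l ∈ Finset.range i, (GateCylinder.cylinder (B l))ᶜ) :=
    fun i => mul_nonneg (Finset.prod_nonneg fun b _ => hp.nonneg b) (prob_nonneg (hwp i) _)
  have hmass : ∀ X : Set (Config E), (X = Q ∨ X = Q ∩ U ∨ X = Q ∩ f ∨ X = Q ∩ U ∩ f) →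
      prob p (X ∩ W) = ∑ i ∈ Finset.range k, ((∏ b ∈ B i, p b) *
        prob (GateCylinder.forceOpen p (B i)) (⋂ l ∈ Finset.range i, (GateCylinder.cylinder (B l))ᶜ)) *
          prob (GateCylinder.forceOpen p (B i)) X :=
    fun X hX => prob_inter_routes_eq_sum p k B S hJ hint hnest X (hconn X hX)
  -- the internal-edge reduction of the forced set `B j ∪ B i` to `B j`, for `i < j`
  have hred : ∀ i j, i < j → j < k → ∀ X : Set (Config E),
      (X = Q ∨ X = Q ∩ U ∨ X = Q ∩ f ∨ X = Q ∩ U ∩ f) →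
      prob (GateCylinder.forceOpen p ((L j).foldl (fun acc t => insert t.1 acc) (B i))) X =
        prob (GateCylinder.forceOpen p (B j)) X := by
    intro i j hij hj X hX
    have hint' : ∀ b ∈ B i, ∃ x ∈ S j, ∃ y ∈ S j, ends b = s(x, y) := by
      intro b hb
      obtain ⟨x, hx, y, hy, hxy⟩ := hint i (by omega) b hb
      exact ⟨x, hnest i j hij hj hx, y, hnest i j hij hj hy, hxy⟩
    rw [CDNestedInternal.foldl_insert_edges_eq_union, ← hB j hj, Finset.union_comm]
    exact CDNestedInternal.prob_forceOpen_union_internal p (hJ j hj) hint' X (hconn X hX)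
  -- the ordered propensities
  have hβ : ∀ i j, i < k → j < k → i ≤ j →
      prob (GateCylinder.forceOpen p (B i)) (Q ∩ U) * prob (GateCylinder.forceOpen p (B j)) Q ≤
        prob (GateCylinder.forceOpen p (B j)) (Q ∩ U) * prob (GateCylinder.forceOpen p (B i)) Q := by
    intro i j hi hj hij
    rcases hij.lt_or_eq with hlt | rfl
    · have h := CDNestedRoute.chain_beta p hp (a₂ := a₂) h𝓔 (L j) (B i) (S i) (hJ i hi) (ha₁ i hi)
        (hends j hj) (CDNestedRoute.walk_mono (Finset.singleton_subset_iff.2 (ha₁ i hi)) (hwalk j hj))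
      rw [hred i j hlt hj Q (Or.inl rfl), hred i j hlt hj (Q ∩ U) (Or.inr (Or.inl rfl))] at h
      exact h
    · exact le_rfl
  have hγ : ∀ i j, i < k → j < k → i ≤ j →
      prob (GateCylinder.forceOpen p (B j)) (Q ∩ f) * prob (GateCylinder.forceOpen p (B i)) Q ≤
        prob (GateCylinder.forceOpen p (B i)) (Q ∩ f) * prob (GateCylinder.forceOpen p (B j)) Q := by
    intro i j hi hj hij
    rcases hij.lt_or_eq with hlt | rfl
    · have h := CDNestedRoute.chain_gamma p hp (a₂ := a₂) (o := o) (L j) (B i) (S i) (hJ i hi)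
        (ha₁ i hi) (hends j hj)
        (CDNestedRoute.walk_mono (Finset.singleton_subset_iff.2 (ha₁ i hi)) (hwalk j hj))
      rw [hred i j hlt hj Q (Or.inl rfl), hred i j hlt hj (Q ∩ f) (Or.inr (Or.inr (Or.inl rfl)))] at h
      exact h
    · exact le_rfl
  refine CDNestedMixture.cd_of_worlds p hp k (fun i => GateCylinder.forceOpen p (B i)) hwp ends
    a₁ a₂ a₃ o h𝓔 (fun i => (∏ b ∈ B i, p b) * prob (GateCylinder.forceOpen p (B i))
      (⋂ l ∈ Finset.range i, (GateCylinder.cylinder (B l))ᶜ)) hν0 ?_ ?_ ?_ ?_ hβ hγ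
  · show prob p (Q ∩ U ∩ e ∩ f) = _
    rw [eA, hmass _ (Or.inr (Or.inr (Or.inr rfl)))]
  · show prob p (Q ∩ U ∩ e) = _
    rw [eB, hmass _ (Or.inr (Or.inl rfl))]
  · show prob p (Q ∩ e ∩ f) = _
    rw [eC, hmass _ (Or.inr (Or.inr (Or.inl rfl)))]
  · show prob p (Q ∩ e) = _
    rw [eD, hmass _ (Or.inl rfl)]

/-- **The nested-routes theorem with the one-way route hypothesis.** In place of `hQe` it suffices that
every route reaches `a₃` (`a₃ ∈ S i`) and that every configuration with `a₁ ↮ a₂` and `a₁ ↔ a₃` has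
some route open — the form in which an instance is checked. -/
theorem cd_of_nested_routes' (p : E → R) (hp : IsProbVec p) {ends : E → Sym2 V} {a₁ a₂ a₃ o : V}
    (k : ℕ) (L : ℕ → List (E × V × V)) (B : ℕ → Finset E) (S : ℕ → Finset V)
    (hB : ∀ i, i < k → B i = (L i).foldl (fun acc t => insert t.1 acc) (∅ : Finset E))
    (hS : ∀ i, i < k → S i = (L i).foldl (fun acc t => insert t.2.2 acc) ({a₁} : Finset V))
    (hends : ∀ i, i < k → ∀ t ∈ L i, ends t.1 = s(t.2.1, t.2.2))
    (hwalk : ∀ i, i < k → ∀ j (hj : j < (L i).length), ((L i).get ⟨j, hj⟩).2.1 ∈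
      ({a₁} : Finset V) ∪ (((L i).take j).map (fun u => u.2.2)).toFinset)
    (h3 : ∀ i, i < k → a₃ ∈ S i)
    (hnest : ∀ l i, l < i → i < k → S l ⊆ S i) {𝓔 : Set (Set V)} (h𝓔 : IsUpperSet 𝓔)
    (hroute : ∀ ω : Config E, ¬ Conn ends ω a₁ a₂ → Conn ends ω a₁ a₃ →
      ∃ i, i < k ∧ ω ∈ GateCylinder.cylinder (B i)) :
    let Q := (connEvent ends a₁ a₂)ᶜ
    let U := clusterInEvent ends a₁ 𝓔
    let e := connEvent ends a₁ a₃
    let f := connEvent ends a₂ o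
    let N := (connEvent ends a₁ a₃)ᶜ ∩ (connEvent ends a₂ a₃)ᶜ
    let oU := connEvent ends a₁ o ∪ connEvent ends a₂ o
    prob p (Q ∩ N) * (prob p Q * prob p (Q ∩ U ∩ e ∩ f) - prob p (Q ∩ U) * prob p (Q ∩ e ∩ f)) ≤
      prob p (Q ∩ N ∩ oU) * (prob p Q * prob p (Q ∩ U ∩ e) - prob p (Q ∩ U) * prob p (Q ∩ e)) := by
  refine cd_of_nested_routes p hp k L B S hB hS hends hwalk hnest h𝓔 ?_
  ext ω
  simp only [Set.mem_inter_iff, Set.mem_compl_iff, mem_connEvent, Set.mem_iUnion, Finset.mem_range,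
    exists_prop]
  constructor
  · rintro ⟨hQ, he⟩
    exact ⟨hQ, hroute ω hQ he⟩
  · rintro ⟨hQ, i, hi, hω⟩
    refine ⟨hQ, ?_⟩
    have hJ := CDNestedRoute.chain_joined (L i) ∅ {a₁} (CDNestedStep.joined_singleton ends ∅ a₁)
      (hends i hi) (hwalk i hi)
    rw [hB i hi] at hω
    exact hJ ω hω a₃ (by rw [← hS i hi]; exact h3 i hi)

end Theorem

end CDNestedRoutes

end Summit.Ventures.PercRepro2
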